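import Literature.Analysis.FluidPDE.WeakSolutionProofs
import Literature.Analysis.FunctionSpaces.TorusSpaceTime
import HarnessLib

/-!
# Weak Navier–Stokes / Euler solutions through a singular time

Topic `Literature/Analysis/FluidPDE` (support file for the `2½`-dimensional assembly of
Cheskidov 2023, Thm. 2.1). The perfect-mixing constructions of Bruè–De Lellis (Comm. Math. Phys.
400 (2023), §5) and Cheskidov (arXiv:2311.04182, §3–§4) produce a classical solution `u` of the
forced Euler / Navier–Stokes system on `[0, T₁) × T^d` which stays bounded but loses its
smoothness as `t → T₁⁻`, converging weakly in `L²` to `0`; it is then extended by `0` to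
`[T₁, T]`. Cheskidov 2023, §4 (p. 12) records that the extension "is a weak solution of the
Euler equation with force `f = (g, 0)` … on the extended time interval `[0, 2]`", the force being
extended by `0` as well. This file proves the underlying abstract statement over the accepted
notions (`Torus.IsClassicalNSSolutionOn`, `Torus.IsWeakNSSolutionForcedOn`):

* `Torus.isWeakNSSolutionForcedOn_of_vanishing` — if `(u, p)` is a classical solution with
  force `f` on `Ico 0 T₁`, `u` and `f` are uniformly bounded there, `u(t) = 0` on `[T₁, T]`,
  `f(t) = 0` on `[T₁, T)`, and `∫ ⟪u(t), w⟫ → 0` as `t → T₁⁻` for every smooth `w`, then `u` is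
  a forced weak solution with datum `u 0` on `T^d × [0, T)`.

The proof is the one printed for classical solutions (Robinson–Rodrigo–Sadowski 2016, §3.1;
the accepted `Torus.IsClassicalNSSolutionOn.isWeakNSSolutionForcedOn_holds`) on every
`[0, T'] ⊂ [0, T₁)`: the pairing `E(t) = ∫ ⟪u(t), ψ(t)⟫` with a divergence-free test field has
derivative the weak integrand, so `∫₀^{T'} (weak integrand) = E(T') - E(0)`; then `T' → T₁⁻`,
where `E(T') → 0` by the weak vanishing and the uniform bound (the test field being uniformly
continuous in time), the weak integrand being bounded, hence integrable, on `(0, T₁)`, and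
vanishing on `[T₁, T)`.

## References

* A. Cheskidov, arXiv:2311.04182 (2023), §4, p. 12 (the extension of `u = (ṽ, ρ̃)` by zero).
* E. Bruè, C. De Lellis, Comm. Math. Phys. 400 (2023), §5.
* J. C. Robinson, J. L. Rodrigo, W. Sadowski, *The Three-Dimensional Navier–Stokes Equations*
  (CUP 2016), §3.1.
-/

noncomputable section

open MeasureTheory Set Filter
open _root_.Topology
open scoped ENNReal NNReal InnerProductSpace

namespace Literature.Analysis.FluidPDE.Torus

open Literature.Analysis.FunctionSpaces Literature.Analysis.FunctionSpaces.Torus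

variable {d : Type*} [Fintype d] [DecidableEq d]

/-! ## The weak integrand of a classical solution is the derivative of the pairing -/

section Pairing

variable {S : Set ℝ} {ν : ℝ} {f u : ℝ → UnitAddTorus d → EuclideanSpace ℝ d}
  {p : ℝ → UnitAddTorus d → ℝ} {ψ : ℝ → UnitAddTorus d → EuclideanSpace ℝ d} {T : ℝ}

/-- For a classical solution on a convex time set `S` with unique one-sided derivatives and a
divergence-free space–time test field `ψ`, the one-sided derivative within `S` of the pairing
`t ↦ ∫ ⟪u(t), ψ(t)⟫` at `t ∈ S` is the weak integrand
`∫ (⟪u, ∂ₜψ⟫ + ⟪u, (u·∇)ψ⟫ + ν⟪u, Δψ⟫ + ⟪f, ψ⟫)` (insert the momentum equation and integrate by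
parts on `T^d`; Robinson–Rodrigo–Sadowski 2016, §3.1). [cite: RobinsonRodrigoSadowski2016, §3.1] -/
theorem integral_timeDerivWithin_inner_eq (h : FunctionSpaces.Torus.IsClassicalNSSolutionOn S ν f u p)
    (hU : UniqueDiffOn ℝ S) (hψ : IsSpaceTimeTest T ψ) (hψdiv : IsDivFreeTest ψ) {t : ℝ} (ht : t ∈ S) :
    ∫ x, FunctionSpaces.Torus.timeDerivWithin S (fun s x => ⟪u s x, ψ s x⟫_ℝ) t x =
      ∫ x, (⟪u t x, FunctionSpaces.Torus.timeDeriv ψ t x⟫_ℝ +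
        ⟪u t x, FunctionSpaces.Torus.convect (u t) (ψ t) x⟫_ℝ +
        ν * ⟪u t x, FunctionSpaces.Torus.laplacian (ψ t) x⟫_ℝ + ⟪f t x, ψ t x⟫_ℝ) := by
  have hu : FunctionSpaces.Torus.IsSmoothSpaceTimeOn S u := h.smooth_velocity
  obtain ⟨hψs, -⟩ := id hψ
  have hψS : FunctionSpaces.Torus.IsSmoothSpaceTimeOn S ψ := hψs.contDiffOn
  have hut : IsSmooth (u t) := hu.isSmooth_slice ht
  have hpt : IsSmooth (p t) := h.smooth_pressure.isSmooth_slice ht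
  have hψt : IsSmooth (ψ t) := hψS.isSmooth_slice ht
  have hψ't : IsSmooth (FunctionSpaces.Torus.timeDeriv ψ t) := hψ.timeDeriv.isSmooth_slice t
  have hAI : IsSmooth (FunctionSpaces.Torus.timeDerivWithin S u t) := hu.isSmooth_timeDerivWithin hU ht
  -- the momentum equation, solved for `∂ₜu`
  have h3 : ∀ x, FunctionSpaces.Torus.timeDerivWithin S u t x =
      ν • FunctionSpaces.Torus.laplacian (u t) x - FunctionSpaces.Torus.gradient (p t) x -
        FunctionSpaces.Torus.convect (u t) (u t) x + f t x := fun x => by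
    have hm := h.momentum t ht x
    rw [← sub_eq_zero] at hm ⊢
    rw [← hm]
    abel
  -- hence the force slice `f t` is smooth
  have hft : IsSmooth (f t) := by
    have hfeq : f t = fun x => FunctionSpaces.Torus.timeDerivWithin S u t x +
        FunctionSpaces.Torus.convect (u t) (u t) x - ν • FunctionSpaces.Torus.laplacian (u t) x +
        FunctionSpaces.Torus.gradient (p t) x := by
      funext x
      rw [h3 x]
      abel
    rw [hfeq]
    exact ((hAI.add (hut.convect hut)).sub (hut.laplacian.smul ν)).add hpt.gradient
  -- pointwise: `∂ₜ⟪u, ψ⟫ = ⟪u, ∂ₜψ⟫ + ⟪νΔu - ∇p - (u·∇)u + f, ψ⟫`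
  have hslice : ∀ x, FunctionSpaces.Torus.timeDerivWithin S (fun t x => ⟪u t x, ψ t x⟫_ℝ) t x =
      ⟪u t x, FunctionSpaces.Torus.timeDeriv ψ t x⟫_ℝ +
        ⟪ν • FunctionSpaces.Torus.laplacian (u t) x - FunctionSpaces.Torus.gradient (p t) x -
          FunctionSpaces.Torus.convect (u t) (u t) x + f t x, ψ t x⟫_ℝ := by
    intro x
    have h1 : HasDerivWithinAt (fun τ => u τ x) (FunctionSpaces.Torus.timeDerivWithin S u t x) S t :=
      hu.hasDerivWithinAt_slice ht x
    have h2 : HasDerivWithinAt (fun τ => ψ τ x) (FunctionSpaces.Torus.timeDeriv ψ t x) S t := by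
      obtain ⟨y, rfl⟩ := FunctionSpaces.Torus.proj_surjective x
      have hd : Differentiable ℝ (fun τ : ℝ => FunctionSpaces.Torus.stLift ψ (τ, y)) :=
        (hψs.differentiable (by simp)).comp (differentiable_id.prodMk (differentiable_const y))
      exact (hd t).hasDerivAt.hasDerivWithinAt
    have h12 := (h1.inner ℝ h2).derivWithin (hU t ht)
    rw [FunctionSpaces.Torus.timeDerivWithin, h12, h3]
  -- integrate over the torus and integrate by parts
  have i1 : Integrable (fun x => ⟪u t x, FunctionSpaces.Torus.timeDeriv ψ t x⟫_ℝ) volume :=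
    (hut.inner hψ't).integrable
  have i2 : Integrable (fun x => ⟪u t x, FunctionSpaces.Torus.convect (u t) (ψ t) x⟫_ℝ) volume :=
    (hut.inner (hut.convect hψt)).integrable
  have i12 : Integrable (fun x => ⟪u t x, FunctionSpaces.Torus.timeDeriv ψ t x⟫_ℝ +
      ⟪u t x, FunctionSpaces.Torus.convect (u t) (ψ t) x⟫_ℝ) volume := i1.add i2
  have i3 : Integrable (fun x => ν * ⟪u t x, FunctionSpaces.Torus.laplacian (ψ t) x⟫_ℝ) volume :=
    ((hut.inner hψt.laplacian).integrable).const_mul ν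
  have i123 : Integrable (fun x => ⟪u t x, FunctionSpaces.Torus.timeDeriv ψ t x⟫_ℝ +
      ⟪u t x, FunctionSpaces.Torus.convect (u t) (ψ t) x⟫_ℝ +
      ν * ⟪u t x, FunctionSpaces.Torus.laplacian (ψ t) x⟫_ℝ) volume := i12.add i3
  have iF : Integrable (fun x => ⟪f t x, ψ t x⟫_ℝ) volume := (hft.inner hψt).integrable
  have iL : Integrable (fun x => ⟪ν • FunctionSpaces.Torus.laplacian (u t) x, ψ t x⟫_ℝ) volume :=
    ((hut.laplacian.smul ν).inner hψt).integrable
  have iG : Integrable (fun x => ⟪FunctionSpaces.Torus.gradient (p t) x, ψ t x⟫_ℝ) volume :=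
    (hpt.gradient.inner hψt).integrable
  have iC : Integrable (fun x => ⟪FunctionSpaces.Torus.convect (u t) (u t) x, ψ t x⟫_ℝ) volume :=
    ((hut.convect hut).inner hψt).integrable
  have iLG : Integrable (fun x => ⟪ν • FunctionSpaces.Torus.laplacian (u t) x, ψ t x⟫_ℝ -
      ⟪FunctionSpaces.Torus.gradient (p t) x, ψ t x⟫_ℝ) volume := iL.sub iG
  have iLGC : Integrable (fun x => ⟪ν • FunctionSpaces.Torus.laplacian (u t) x, ψ t x⟫_ℝ -
      ⟪FunctionSpaces.Torus.gradient (p t) x, ψ t x⟫_ℝ -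
      ⟪FunctionSpaces.Torus.convect (u t) (u t) x, ψ t x⟫_ℝ) volume := iLG.sub iC
  have iLGCF : Integrable (fun x => ⟪ν • FunctionSpaces.Torus.laplacian (u t) x, ψ t x⟫_ℝ -
      ⟪FunctionSpaces.Torus.gradient (p t) x, ψ t x⟫_ℝ -
      ⟪FunctionSpaces.Torus.convect (u t) (u t) x, ψ t x⟫_ℝ + ⟪f t x, ψ t x⟫_ℝ) volume := iLGC.add iF
  have hlap : ∫ x, ⟪ν • FunctionSpaces.Torus.laplacian (u t) x, ψ t x⟫_ℝ =
      ∫ x, ν * ⟪u t x, FunctionSpaces.Torus.laplacian (ψ t) x⟫_ℝ := by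
    simp_rw [real_inner_smul_left, integral_const_mul]
    rw [FunctionSpaces.Torus.integral_inner_laplacian_comm hut hψt]
  have hgrad : ∫ x, ⟪FunctionSpaces.Torus.gradient (p t) x, ψ t x⟫_ℝ = 0 :=
    FunctionSpaces.Torus.integral_inner_gradient_eq_zero_of_isDivFree hψt hpt (hψdiv t)
  have hconv : ∫ x, ⟪FunctionSpaces.Torus.convect (u t) (u t) x, ψ t x⟫_ℝ =
      -∫ x, ⟪u t x, FunctionSpaces.Torus.convect (u t) (ψ t) x⟫_ℝ :=
    FunctionSpaces.Torus.integral_inner_convect_eq_neg hut (h.divFree t ht) hut hψt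
  rw [integral_add i123 iF, integral_add i12 i3, integral_add i1 i2]
  simp_rw [hslice, inner_add_left, inner_sub_left]
  rw [integral_add i1 iLGCF, integral_add iLGC iF, integral_sub iLG iC, integral_sub iL iG, hlap,
    hgrad, hconv]
  ring

/-- **Integrated form.** For a classical solution on a convex time set `S` with unique
one-sided derivatives, a divergence-free space–time test field `ψ` and `[a, b] ⊆ S`, `a < b`:
`∫ₐᵇ ∫ (⟪u, ∂ₜψ⟫ + ⟪u, (u·∇)ψ⟫ + ν⟪u, Δψ⟫ + ⟪f, ψ⟫) = ∫ ⟪u(b), ψ(b)⟫ - ∫ ⟪u(a), ψ(a)⟫`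
(fundamental theorem of calculus for the pairing; Robinson–Rodrigo–Sadowski 2016, §3.1). [cite: RobinsonRodrigoSadowski2016, §3.1] -/
theorem setIntegral_weakIntegrand_eq_sub (h : FunctionSpaces.Torus.IsClassicalNSSolutionOn S ν f u p)
    (hS : Convex ℝ S) (hU : UniqueDiffOn ℝ S) (hψ : IsSpaceTimeTest T ψ) (hψdiv : IsDivFreeTest ψ)
    {a b : ℝ} (hab : a < b) (habS : Icc a b ⊆ S) :
    ∫ t in Ioo a b, ∫ x, (⟪u t x, FunctionSpaces.Torus.timeDeriv ψ t x⟫_ℝ +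
        ⟪u t x, FunctionSpaces.Torus.convect (u t) (ψ t) x⟫_ℝ +
        ν * ⟪u t x, FunctionSpaces.Torus.laplacian (ψ t) x⟫_ℝ + ⟪f t x, ψ t x⟫_ℝ) =
      (∫ x, ⟪u b x, ψ b x⟫_ℝ) - ∫ x, ⟪u a x, ψ a x⟫_ℝ := by
  have hu : FunctionSpaces.Torus.IsSmoothSpaceTimeOn S u := h.smooth_velocity
  have hψS : FunctionSpaces.Torus.IsSmoothSpaceTimeOn S ψ := hψ.1.contDiffOn
  have hg : FunctionSpaces.Torus.IsSmoothSpaceTimeOn S (fun t x => ⟪u t x, ψ t x⟫_ℝ) := hu.inner hψS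
  set E : ℝ → ℝ := fun t => ∫ x, ⟪u t x, ψ t x⟫_ℝ with hE_def
  set E' : ℝ → ℝ := fun t =>
    ∫ x, FunctionSpaces.Torus.timeDerivWithin S (fun t x => ⟪u t x, ψ t x⟫_ℝ) t x with hE'_def
  have hE : ∀ t ∈ S, HasDerivWithinAt E (E' t) S t := fun t ht =>
    hg.hasDerivWithinAt_integral hS ht
  have hE'cont : ContinuousOn E' S := hg.continuousOn_integral_timeDerivWithin hU
  have hFTC : ∫ t in Ioo a b, E' t = E b - E a := by
    rw [← integral_Ioc_eq_integral_Ioo, ← intervalIntegral.integral_of_le hab.le,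
      intervalIntegral.integral_eq_sub_of_hasDerivAt_of_le hab.le
        (fun t ht => ((hE t (habS ht)).continuousWithinAt.mono habS))
        (fun t ht => (hE t (habS (Ioo_subset_Icc_self ht))).hasDerivAt
          (mem_of_superset (Icc_mem_nhds ht.1 ht.2) habS))
        ((hE'cont.mono ((uIcc_of_le hab.le).subset.trans habS)).intervalIntegrable)]
  rw [← hFTC]
  refine setIntegral_congr_fun measurableSet_Ioo fun t ht => ?_
  exact (integral_timeDerivWithin_inner_eq h hU hψ hψdiv (habS (Ioo_subset_Icc_self ht))).symm

end Pairing


/-! ## Classical solutions only depend on their values on the time set -/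

section Congr

variable {S : Set ℝ} {ν : ℝ} {f f' u u' : ℝ → UnitAddTorus d → EuclideanSpace ℝ d}
  {p : ℝ → UnitAddTorus d → ℝ}

/-- The notion of classical solution on `S × T^d` only depends on the values of the velocity and
of the force at times `t ∈ S` (one-sided time derivatives within `S` see only values on `S`,
`derivWithin_congr`; all other terms are slice-wise). Used to package fields defined by cases in
time, e.g. a smooth solution on `[0, T₁)` extended by zero afterwards. [folklore] -/
theorem _root_.Literature.Analysis.FunctionSpaces.Torus.IsClassicalNSSolutionOn.congr
    (h : FunctionSpaces.Torus.IsClassicalNSSolutionOn S ν f u p) (hu : ∀ t ∈ S, u' t = u t)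
    (hf : ∀ t ∈ S, f' t = f t) : FunctionSpaces.Torus.IsClassicalNSSolutionOn S ν f' u' p where
  smooth_velocity := by
    refine (h.smooth_velocity).congr fun z hz => ?_
    obtain ⟨t, y⟩ := z
    rw [FunctionSpaces.Torus.stLift_apply, FunctionSpaces.Torus.stLift_apply, hu t (mem_prod.1 hz).1]
  smooth_pressure := h.smooth_pressure
  momentum t ht x := by
    have h1 : FunctionSpaces.Torus.timeDerivWithin S u' t x = FunctionSpaces.Torus.timeDerivWithin S u t x :=
      derivWithin_congr (fun s hs => by rw [hu s hs]) (by rw [hu t ht])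
    rw [h1, hu t ht, hf t ht]
    exact h.momentum t ht x
  divFree t ht := by
    rw [hu t ht]
    exact h.divFree t ht

end Congr

/-! ## Weak solutions through a singular time -/

section Singular

variable {T₁ T ν C : ℝ} {f u : ℝ → UnitAddTorus d → EuclideanSpace ℝ d}
  {p : ℝ → UnitAddTorus d → ℝ}

/-- **Weak solutions through a singular time.** Let `(u, p)` be a classical solution of the
forced Navier–Stokes / Euler system with force `f` on `[0, T₁) × T^d`, `T₁ > 0`, such that `u`
and `f` are uniformly bounded on `[0, T₁) × T^d`, `u(t) = 0` for `t ∈ [T₁, T]`, `f(t) = 0` for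
`t ∈ [T₁, T)`, and `u(t) ⇀ 0` as `t → T₁⁻` in the sense that `∫ ⟪u(t), w⟫ → 0` for every smooth
`w`. Then `u` is a forced weak solution with datum `u(0)` on `T^d × [0, T)`
(`Torus.IsWeakNSSolutionForcedOn T ν f (u 0) u`). This is the statement behind Cheskidov 2023,
§4, p. 12: the `2½`-dimensional Euler solution `u = (ṽ, ρ̃)`, smooth on `[0,1)` with
`u(t) ⇀ 0` as `t → 1⁻` and extended by zero, "is a weak solution of the Euler equation with
force `f = (g,0)` … on the extended time interval `[0,2]`". Proof: on `[0, T'] ⊂ [0, T₁)` the weak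
integrand integrates to `∫ ⟪u(T'), ψ(T')⟫ - ∫ ⟪u(0), ψ(0)⟫` (`setIntegral_weakIntegrand_eq_sub`);
let `T' → T₁⁻`. [cite: Cheskidov2023, §4 p. 12] -/
theorem isWeakNSSolutionForcedOn_of_vanishing (hT₁ : 0 < T₁) (hT₁T : T₁ ≤ T)
    (hcl : FunctionSpaces.Torus.IsClassicalNSSolutionOn (Ico 0 T₁) ν f u p)
    (hu0 : ∀ t ∈ Icc T₁ T, u t = 0) (hf0 : ∀ t ∈ Ico T₁ T, f t = 0)
    (huC : ∀ t ∈ Ico (0 : ℝ) T₁, ∀ x, ‖u t x‖ ≤ C) (hfC : ∀ t ∈ Ico (0 : ℝ) T₁, ∀ x, ‖f t x‖ ≤ C)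
    (hweak : ∀ w : UnitAddTorus d → EuclideanSpace ℝ d, IsSmooth w →
      Tendsto (fun t => ∫ x, ⟪u t x, w x⟫_ℝ) (𝓝[<] T₁) (𝓝 0)) :
    IsWeakNSSolutionForcedOn T ν f (u 0) u := by
  have hS : Convex ℝ (Ico (0 : ℝ) T₁) := convex_Ico 0 T₁
  have hU : UniqueDiffOn ℝ (Ico (0 : ℝ) T₁) := uniqueDiffOn_Ico 0 T₁
  have hu : FunctionSpaces.Torus.IsSmoothSpaceTimeOn (Ico 0 T₁) u := hcl.smooth_velocity
  have h0mem : (0 : ℝ) ∈ Ico (0 : ℝ) T₁ := ⟨le_rfl, hT₁⟩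
  have hC0 : 0 ≤ C := (norm_nonneg _).trans (huC 0 h0mem 0)
  have hT : 0 < T := hT₁.trans_le hT₁T
  refine ⟨?_, ?_, ?_, ?_⟩
  -- (1) measurability on `(0,T) × ℝ^d`: continuous on `(0,T₁) × ℝ^d`, zero afterwards
  · have hset : Ioo 0 T ×ˢ (univ : Set (EuclideanSpace ℝ d)) =
        (Ioo 0 T₁ ×ˢ univ) ∪ (Ico T₁ T ×ˢ univ) := by
      rw [← union_prod, Ioo_union_Ico_eq_Ioo hT₁ hT₁T]
    rw [hset]
    refine aestronglyMeasurable_union_iff.2 ⟨?_, ?_⟩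
    · exact hu.aestronglyMeasurable_stLift measurableSet_Ioo Ioo_subset_Ico_self
    · have hae : (FunctionSpaces.Torus.stLift u) =ᵐ[volume.restrict (Ico T₁ T ×ˢ univ)] 0 := by
        filter_upwards [ae_restrict_mem (measurableSet_Ico.prod MeasurableSet.univ)] with z hz
        obtain ⟨t, y⟩ := z
        rw [FunctionSpaces.Torus.stLift_apply, hu0 t ⟨(mem_prod.1 hz).1.1, (mem_prod.1 hz).1.2.le⟩]
        rfl
      exact aestronglyMeasurable_const.congr hae.symm
  -- (2) square integrability: `u` is bounded
  · have hb : ∀ t ∈ Ioo 0 T, ∀ x, ‖u t x‖ₑ ^ 2 ≤ ENNReal.ofReal C ^ 2 := by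
      intro t ht x
      rcases lt_or_ge t T₁ with h1 | h1
      · gcongr
        rw [← ofReal_norm]
        exact ENNReal.ofReal_le_ofReal (huC t ⟨ht.1.le, h1⟩ x)
      · rw [hu0 t ⟨h1, ht.2.le⟩]
        simp
    calc ∫⁻ t in Ioo 0 T, ∫⁻ x, ‖u t x‖ₑ ^ 2
        ≤ ∫⁻ _ in Ioo 0 T, ENNReal.ofReal C ^ 2 :=
          setLIntegral_mono' measurableSet_Ioo fun t ht =>
            calc ∫⁻ x, ‖u t x‖ₑ ^ 2 ≤ ∫⁻ _, ENNReal.ofReal C ^ 2 := lintegral_mono (hb t ht)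
              _ = ENNReal.ofReal C ^ 2 := by rw [lintegral_const, measure_univ, mul_one]
      _ = ENNReal.ofReal C ^ 2 * volume (Ioo 0 T) := setLIntegral_const _ _
      _ < ⊤ := ENNReal.mul_lt_top (ENNReal.pow_lt_top ENNReal.ofReal_lt_top)
          (by rw [Real.volume_Ioo]; exact ENNReal.ofReal_lt_top)
  -- (3) weakly divergence free slices
  · refine (ae_restrict_iff' measurableSet_Ioo).2 (ae_of_all _ fun t ht => ?_)
    rcases lt_or_ge t T₁ with h1 | h1
    · exact (hcl.divFree t ⟨ht.1.le, h1⟩).isWeaklyDivFree_holds (hu.isSmooth_slice ⟨ht.1.le, h1⟩)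
    · intro θ _
      simp [hu0 t ⟨h1, ht.2.le⟩]
  -- (4) the weak identity with datum
  · intro ψ hψ hψdiv
    -- the weak integrand `I` and the pairing `E`
    set I : ℝ → ℝ := fun t => ∫ x, (⟪u t x, FunctionSpaces.Torus.timeDeriv ψ t x⟫_ℝ +
        ⟪u t x, FunctionSpaces.Torus.convect (u t) (ψ t) x⟫_ℝ +
        ν * ⟪u t x, FunctionSpaces.Torus.laplacian (ψ t) x⟫_ℝ + ⟪f t x, ψ t x⟫_ℝ) with hI_def
    set E : ℝ → ℝ := fun t => ∫ x, ⟪u t x, ψ t x⟫_ℝ with hE_def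
    have hψu : FunctionSpaces.Torus.IsSmoothSpaceTimeOn univ ψ := hψ.isSmoothSpaceTimeOn univ
    -- (a) the integrand vanishes on `[T₁, T)`
    have hI0 : ∀ t ∈ Ico T₁ T, I t = 0 := by
      intro t ht
      simp only [hI_def, hu0 t ⟨ht.1, ht.2.le⟩, hf0 t ht, Pi.zero_apply, inner_zero_left,
        mul_zero, add_zero, integral_zero]
    -- (b) FTC on `[0, T'] ⊂ [0, T₁)`
    have hIT' : ∀ T' ∈ Ioo (0 : ℝ) T₁, ∫ t in Ioo 0 T', I t = E T' - E 0 := fun T' hT' =>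
      setIntegral_weakIntegrand_eq_sub hcl hS hU hψ hψdiv hT'.1 (Icc_subset_Ico_right hT'.2)
    -- (c) the integrand equals the continuous `E'` on `[0, T₁)` and is bounded
    set E' : ℝ → ℝ := fun t => ∫ x, FunctionSpaces.Torus.timeDerivWithin (Ico 0 T₁)
      (fun t x => ⟪u t x, ψ t x⟫_ℝ) t x with hE'_def
    have hIE' : ∀ t ∈ Ico (0 : ℝ) T₁, I t = E' t := fun t ht =>
      (integral_timeDerivWithin_inner_eq hcl hU hψ hψdiv ht).symm
    have hE'cont : ContinuousOn E' (Ico 0 T₁) :=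
      (hu.inner (hψ.1.contDiffOn)).continuousOn_integral_timeDerivWithin hU
    obtain ⟨A₀, hA₀⟩ := hψu.exists_norm_le_of_isCompact isCompact_Icc (subset_univ (Icc 0 T₁))
    obtain ⟨A₁, hA₁⟩ := (hψ.timeDeriv.isSmoothSpaceTimeOn univ).exists_norm_le_of_isCompact
      isCompact_Icc (subset_univ (Icc 0 T₁))
    obtain ⟨A₃, hA₃⟩ := (hψu.laplacian uniqueDiffOn_univ).exists_norm_le_of_isCompact
      isCompact_Icc (subset_univ (Icc 0 T₁))
    have hpd : ∀ i : d, ∃ A : ℝ, ∀ t ∈ Icc (0 : ℝ) T₁, ∀ x,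
        ‖FunctionSpaces.Torus.partialDeriv i (ψ t) x‖ ≤ A := fun i =>
      (hψu.partialDeriv uniqueDiffOn_univ i).exists_norm_le_of_isCompact isCompact_Icc (subset_univ _)
    choose A₂ hA₂ using hpd
    set K : ℝ := C * A₁ + C * (C * ∑ i, A₂ i) + |ν| * (C * A₃) + C * A₀ with hK_def
    have hIK : ∀ t ∈ Ico (0 : ℝ) T₁, ‖I t‖ ≤ K := by
      intro t ht
      have htc : t ∈ Icc (0 : ℝ) T₁ := Ico_subset_Icc_self ht
      have hψt1 : IsContDiff 1 (ψ t) := (hψ.isSmooth_slice t).isContDiff (by simp)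
      have hpt : ∀ x, ‖⟪u t x, FunctionSpaces.Torus.timeDeriv ψ t x⟫_ℝ +
          ⟪u t x, FunctionSpaces.Torus.convect (u t) (ψ t) x⟫_ℝ +
          ν * ⟪u t x, FunctionSpaces.Torus.laplacian (ψ t) x⟫_ℝ + ⟪f t x, ψ t x⟫_ℝ‖ ≤ K := by
        intro x
        have hux : ‖u t x‖ ≤ C := huC t ht x
        have e1 : ‖⟪u t x, FunctionSpaces.Torus.timeDeriv ψ t x⟫_ℝ‖ ≤ C * A₁ :=
          (norm_inner_le_norm _ _).trans (mul_le_mul hux (hA₁ t htc x) (norm_nonneg _) hC0)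
        have e2 : ‖⟪u t x, FunctionSpaces.Torus.convect (u t) (ψ t) x⟫_ℝ‖ ≤ C * (C * ∑ i, A₂ i) := by
          refine (norm_inner_le_norm _ _).trans (mul_le_mul hux ?_ (norm_nonneg _) hC0)
          rw [FunctionSpaces.Torus.convect, fderiv_apply_eq_sum_partialDeriv hψt1, Finset.mul_sum]
          refine (norm_sum_le _ _).trans (Finset.sum_le_sum fun i _ => ?_)
          rw [norm_smul]
          have hui : ‖u t x i‖ ≤ ‖u t x‖ := by simpa using PiLp.norm_apply_le (u t x) i
          exact mul_le_mul (hui.trans hux) (hA₂ i t htc x) (norm_nonneg _) hC0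
        have e3 : ‖ν * ⟪u t x, FunctionSpaces.Torus.laplacian (ψ t) x⟫_ℝ‖ ≤ |ν| * (C * A₃) := by
          rw [norm_mul, Real.norm_eq_abs]
          exact mul_le_mul_of_nonneg_left
            ((norm_inner_le_norm _ _).trans (mul_le_mul hux (hA₃ t htc x) (norm_nonneg _) hC0))
            (abs_nonneg ν)
        have e4 : ‖⟪f t x, ψ t x⟫_ℝ‖ ≤ C * A₀ :=
          (norm_inner_le_norm _ _).trans (mul_le_mul (hfC t ht x) (hA₀ t htc x) (norm_nonneg _) hC0)
        calc _ ≤ ‖⟪u t x, FunctionSpaces.Torus.timeDeriv ψ t x⟫_ℝ +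
              ⟪u t x, FunctionSpaces.Torus.convect (u t) (ψ t) x⟫_ℝ +
              ν * ⟪u t x, FunctionSpaces.Torus.laplacian (ψ t) x⟫_ℝ‖ + ‖⟪f t x, ψ t x⟫_ℝ‖ :=
              norm_add_le _ _
          _ ≤ (‖⟪u t x, FunctionSpaces.Torus.timeDeriv ψ t x⟫_ℝ +
              ⟪u t x, FunctionSpaces.Torus.convect (u t) (ψ t) x⟫_ℝ‖ +
              ‖ν * ⟪u t x, FunctionSpaces.Torus.laplacian (ψ t) x⟫_ℝ‖) + ‖⟪f t x, ψ t x⟫_ℝ‖ := by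
              gcongr; exact norm_add_le _ _
          _ ≤ (‖⟪u t x, FunctionSpaces.Torus.timeDeriv ψ t x⟫_ℝ‖ +
              ‖⟪u t x, FunctionSpaces.Torus.convect (u t) (ψ t) x⟫_ℝ‖ +
              ‖ν * ⟪u t x, FunctionSpaces.Torus.laplacian (ψ t) x⟫_ℝ‖) + ‖⟪f t x, ψ t x⟫_ℝ‖ := by
              gcongr; exact norm_add_le _ _
          _ ≤ K := by rw [hK_def]; gcongr
      calc ‖I t‖ ≤ K * (volume : Measure (UnitAddTorus d)).real univ :=
            norm_integral_le_of_norm_le_const (ae_of_all _ hpt)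
        _ = K := by simp
    -- (d) integrability of the weak integrand on `(0, T)`
    have hint1 : IntegrableOn I (Ioo 0 T₁) volume := by
      refine IntegrableOn.of_bound (by rw [Real.volume_Ioo]; exact ENNReal.ofReal_lt_top)
        ((hE'cont.mono Ioo_subset_Ico_self).aestronglyMeasurable measurableSet_Ioo |>.congr ?_) K ?_
      · exact (ae_restrict_iff' measurableSet_Ioo).2 (ae_of_all _ fun t ht =>
          (hIE' t (Ioo_subset_Ico_self ht)).symm)
      · exact (ae_restrict_iff' measurableSet_Ioo).2 (ae_of_all _ fun t ht =>
          hIK t (Ioo_subset_Ico_self ht))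
    have hint2 : IntegrableOn I (Ico T₁ T) volume :=
      (integrableOn_zero).congr_fun (fun t ht => (hI0 t ht).symm) measurableSet_Ico
    -- (e) `E(t) → 0` as `t → T₁⁻`
    have hE : Tendsto E (𝓝[<] T₁) (𝓝 0) := by
      rw [Metric.tendsto_nhds]
      intro ε hε
      have hψ1 : IsSmooth (ψ T₁) := hψ.isSmooth_slice T₁
      have h1 : ∀ᶠ t in 𝓝[<] T₁, dist (∫ x, ⟪u t x, ψ T₁ x⟫_ℝ) 0 < ε / 2 :=
        Metric.tendsto_nhds.1 (hweak (ψ T₁) hψ1) (ε / 2) (half_pos hε)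
      have hδ : 0 < ε / (2 * (C + 1)) := by positivity
      have h2 : ∀ᶠ t in 𝓝[<] T₁, ∀ x, ‖ψ t x - ψ T₁ x‖ < ε / (2 * (C + 1)) := by
        have h := hψu.eventually_norm_sub_lt (mem_univ T₁) hδ
        rw [nhdsWithin_univ] at h
        exact h.filter_mono nhdsWithin_le_nhds
      have h3 : ∀ᶠ t in 𝓝[<] T₁, t ∈ Ico (0 : ℝ) T₁ := Ico_mem_nhdsLT hT₁
      filter_upwards [h1, h2, h3] with t ht1 ht2 ht3
      rw [Real.dist_eq, sub_zero] at ht1 ⊢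
      have hut : IsSmooth (u t) := hu.isSmooth_slice ht3
      have hψt : IsSmooth (ψ t) := hψ.isSmooth_slice t
      have i1 : Integrable (fun x => ⟪u t x, ψ T₁ x⟫_ℝ) volume := (hut.inner hψ1).integrable
      have i2 : Integrable (fun x => ⟪u t x, ψ t x - ψ T₁ x⟫_ℝ) volume :=
        (hut.inner (hψt.sub hψ1)).integrable
      have hsplit : E t = (∫ x, ⟪u t x, ψ T₁ x⟫_ℝ) + ∫ x, ⟪u t x, ψ t x - ψ T₁ x⟫_ℝ := by
        rw [← integral_add i1 i2]
        refine integral_congr_ae (ae_of_all _ fun x => ?_)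
        show ⟪u t x, ψ t x⟫_ℝ = ⟪u t x, ψ T₁ x⟫_ℝ + ⟪u t x, ψ t x - ψ T₁ x⟫_ℝ
        rw [← inner_add_right, add_sub_cancel]
      have hbd : |∫ x, ⟪u t x, ψ t x - ψ T₁ x⟫_ℝ| ≤ C * (ε / (2 * (C + 1))) := by
        have hpt : ∀ x, ‖⟪u t x, ψ t x - ψ T₁ x⟫_ℝ‖ ≤ C * (ε / (2 * (C + 1))) := fun x =>
          (norm_inner_le_norm _ _).trans (mul_le_mul (huC t ht3 x) (ht2 x).le (norm_nonneg _) hC0)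
        have h := norm_integral_le_of_norm_le_const (μ := (volume : Measure (UnitAddTorus d)))
          (ae_of_all _ hpt)
        rw [Real.norm_eq_abs] at h
        simpa using h
      have hlt : C * (ε / (2 * (C + 1))) < ε / 2 := by
        rw [mul_div_assoc', div_lt_div_iff₀ (by positivity) (by positivity)]
        nlinarith
      calc |E t| ≤ |∫ x, ⟪u t x, ψ T₁ x⟫_ℝ| + |∫ x, ⟪u t x, ψ t x - ψ T₁ x⟫_ℝ| := by
            rw [hsplit]; exact abs_add_le _ _
        _ < ε / 2 + ε / 2 := add_lt_add_of_lt_of_le ht1 (hbd.trans hlt.le)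
        _ = ε := add_halves ε
    -- (f) `∫_{(0,T₁)} I = -E 0`
    have hmain : ∫ t in Ioo 0 T₁, I t = -E 0 := by
      have hintIcc : IntegrableOn I (Icc 0 T₁) volume := by
        rw [integrableOn_Icc_iff_integrableOn_Ioo]; exact hint1
      have hF : ContinuousOn (fun x => ∫ t in Ioc 0 x, I t) (Icc 0 T₁) :=
        intervalIntegral.continuousOn_primitive hintIcc
      have hF1 : Tendsto (fun x => ∫ t in Ioc 0 x, I t) (𝓝[<] T₁) (𝓝 (∫ t in Ioc 0 T₁, I t)) :=
        (hF T₁ ⟨hT₁.le, le_rfl⟩).tendsto.mono_left (nhdsWithin_le_of_mem (Icc_mem_nhdsLT hT₁))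
      have hF2 : Tendsto (fun x => ∫ t in Ioc 0 x, I t) (𝓝[<] T₁) (𝓝 (0 - E 0)) := by
        refine (hE.sub_const (E 0)).congr' ?_
        filter_upwards [Ioo_mem_nhdsLT hT₁] with x hx
        rw [integral_Ioc_eq_integral_Ioo, hIT' x hx]
      rw [← integral_Ioc_eq_integral_Ioo, tendsto_nhds_unique hF1 hF2, zero_sub]
    -- conclusion
    have hsplit : ∫ t in Ioo 0 T, I t = ∫ t in Ioo 0 T₁, I t := by
      rw [← Ioo_union_Ico_eq_Ioo hT₁ hT₁T, setIntegral_union ?_ measurableSet_Ico hint1 hint2,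
        setIntegral_eq_zero_of_forall_eq_zero hI0, add_zero]
      exact disjoint_left.2 fun t ht ht' => (not_le.2 ht.2) ht'.1
    change (∫ t in Ioo 0 T, I t) + E 0 = 0
    rw [hsplit, hmain, neg_add_cancel]

end Singular

end Literature.Analysis.FluidPDE.Torus

end
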